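import Literature.NumberTheory.EllipticCurves.EichlerShimuraPeriodsGamma1
import Mathlib.MeasureTheory.Integral.ExpDecay
import Mathlib.LinearAlgebra.Vandermonde
import HarnessLib

/-!
# Eichler–Shimura periods on `S_k(Γ₁(N))`: the iterated Eichler integrals as honest integrals,
# and the periods as limits of integrals from the cusps

Analytic lemmas on the period cocycle `periodFn1` of
`Literature.NumberTheory.EllipticCurves.EichlerShimuraPeriodsGamma1`, used in the proof that the
Eichler–Shimura period lattice of `S_{n+2}(Γ₁(N))` spans the dual space over `ℝ`.

* `IsCuspFunction.powPrimitive_eq_integral`: the iterated integrals `powPrimitive j φ τ` of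
  `EichlerShimuraPeriods` (defined by the integration-by-parts recursion) are the vertical-ray
  integrals `∫_τ^{i∞} φ(z) zʲ dz = i ∫₀^∞ φ(τ + it)(τ + it)ʲ dt`.
* `tendsto_eichlerKernel_cusp`: for `σ = (a b; c d) ∈ Γ₀(N)` with `c ≠ 0` the period
  `c_f(σ)(q)` is minus the limit, as `ε → 0⁺`, of the kernel `∫_{a/c+iε}^{i∞} f(z)(zv' - u')ⁿ dz`,
  `(u', v') = σq` — "the period is the integral from the cusp `σ∞ = a/c`".
* `tendsto_powPrimitive_cusp`: consequently the moments `∫_{a/c+iε}^{i∞} f(z) zʲ dz`, `j ≤ n`,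
  converge as `ε → 0⁺` (coefficient extraction at `n + 1` integer points, Vandermonde).

Everything is proved; there are no named facts.

## References

* G. Shimura, *Introduction to the arithmetic theory of automorphic functions*, Publ. Math. Soc.
  Japan 11 (1971), §8.2 (8.2.12)–(8.2.20).
* Ju. I. Manin, *Periods of parabolic forms and p-adic Hecke series*, Mat. Sb. 92 (1973), §1
  (periods as integrals between cusps).
-/

noncomputable section

open scoped MatrixGroups ModularForm Topology Manifold

open CongruenceSubgroup Complex MeasureTheory Set Filter Function Asymptotics
open UpperHalfPlane hiding I

namespace Literature.NumberTheory.EllipticCurves.ModularForms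

/-! ### Vertical rays: continuity, decay, integrability against polynomials -/

section Rays

variable {h : ℝ} {φ : ℍ → ℂ}

/-- The affine parametrisation `t ↦ τ + it` of the vertical ray has derivative `i`. [folklore] -/
theorem hasDerivAt_ray (τ : ℂ) (t : ℝ) :
    HasDerivAt (fun s : ℝ ↦ τ + s * I) I t := by
  have h1 : HasDerivAt (fun s : ℝ ↦ (s : ℂ)) 1 t := by
    simpa using (hasDerivAt_id t).ofReal_comp
  simpa using (h1.mul_const I).const_add τ

/-- Points of the closed vertical ray above `τ ∈ ℍ` lie in the upper half-plane. [folklore] -/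
theorem im_ray_pos (τ : ℍ) {t : ℝ} (ht : 0 ≤ t) : 0 < ((τ : ℂ) + t * I).im := by
  simpa using lt_of_lt_of_le τ.im_pos (by simpa using ht)

/-- `t ↦ φ(τ + it)` is continuous on `[0, ∞)` for `φ` continuous on `ℍ` (as `φ ∘ ofComplex` on
`{im > 0}`). [folklore] -/
theorem IsCuspFunction.continuousOn_ray_Ici (hφ : IsCuspFunction h φ) (τ : ℍ) :
    ContinuousOn (fun t : ℝ ↦ φ (ofComplex ((τ : ℂ) + t * I))) (Ici 0) := by
  refine hφ.continuousOn_comp_ofComplex.comp (by fun_prop) fun t ht ↦ ?_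
  exact im_ray_pos τ ht

/-- A real function `A (B + t)ᵐ e^{-at}` (`a > 0`) is integrable on `(0, ∞)`. [folklore] -/
theorem integrableOn_affine_pow_mul_exp_neg (A B : ℝ) (m : ℕ) {a : ℝ} (ha : 0 < a) :
    IntegrableOn (fun t : ℝ ↦ A * (B + t) ^ m * Real.exp (-a * t)) (Ioi 0) := by
  refine integrable_of_isBigO_exp_neg (b := a / 2) (half_pos ha) (by fun_prop) ?_
  have hlim : Tendsto (fun t : ℝ ↦ A * ((B + 1 * t) ^ m * Real.exp (-(a / 2) * t))) atTop (𝓝 0) := by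
    have := (tendsto_affine_pow_mul_exp_neg_atTop B 1 m (half_pos ha)).const_mul A
    rwa [mul_zero] at this
  have hev : ∀ᶠ t : ℝ in atTop, ‖A * ((B + 1 * t) ^ m * Real.exp (-(a / 2) * t))‖ ≤ 1 := by
    have := hlim.norm
    rw [norm_zero] at this
    exact (this.eventually (gt_mem_nhds zero_lt_one)).mono fun t ht ↦ ht.le
  refine IsBigO.of_bound 1 ?_
  filter_upwards [hev] with t ht
  rw [Real.norm_of_nonneg (Real.exp_pos _).le, one_mul]
  have : A * (B + t) ^ m * Real.exp (-a * t) =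
      (A * ((B + 1 * t) ^ m * Real.exp (-(a / 2) * t))) * Real.exp (-(a / 2) * t) := by
    rw [one_mul, mul_assoc, mul_assoc, mul_assoc, ← Real.exp_add]
    congr 3
    ring
  rw [this, norm_mul, Real.norm_of_nonneg (Real.exp_pos _).le]
  exact mul_le_of_le_one_left (Real.exp_pos _).le ht

/-- **Integrability of `φ(τ + it)(τ + it)ᵐ` on `(0, ∞)`** for a cusp function `φ` (exponential
decay along the ray, `IsCuspFunction.norm_ray_le`). [folklore] -/
theorem IsCuspFunction.integrableOn_ray_mul_pow (hφ : IsCuspFunction h φ) (τ : ℍ) (m : ℕ) :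
    IntegrableOn (fun t : ℝ ↦ φ (ofComplex ((τ : ℂ) + t * I)) * ((τ : ℂ) + t * I) ^ m) (Ioi 0) := by
  have hh := hφ.pos
  set C : ℝ := ∑' n : ℕ, ‖(qExpansion h φ).coeff n‖ * ‖Periodic.qParam h τ‖ ^ n with hC
  have ha : 0 < 2 * Real.pi / h := by positivity
  refine Integrable.mono' (integrableOn_affine_pow_mul_exp_neg C ‖(τ : ℂ)‖ m ha) ?_ ?_
  · exact ((hφ.continuousOn_ray τ).mul (by fun_prop)).aestronglyMeasurable measurableSet_Ioi
  · rw [ae_restrict_iff' measurableSet_Ioi]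
    refine Eventually.of_forall fun t (ht : 0 < t) ↦ ?_
    rw [norm_mul, norm_pow]
    have h1 := hφ.norm_ray_le τ ht
    have h2 : ‖(τ : ℂ) + t * I‖ ≤ ‖(τ : ℂ)‖ + t := by
      refine (norm_add_le _ _).trans ?_
      rw [norm_mul, Complex.norm_I, mul_one, Complex.norm_real, Real.norm_of_nonneg ht.le]
    calc ‖φ (ofComplex ((τ : ℂ) + t * I))‖ * ‖(τ : ℂ) + t * I‖ ^ m
        ≤ (C * Real.exp (-(2 * Real.pi / h) * t)) * (‖(τ : ℂ)‖ + t) ^ m := by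
          gcongr
      _ = C * (‖(τ : ℂ)‖ + t) ^ m * Real.exp (-(2 * Real.pi / h) * t) := by ring

/-- Exponential bound for a cusp function along the closed ray: `‖φ(τ + it)‖ ≤ C e^{-at}` for all
`t ≥ 0`, with the constant of `norm_ray_le` at the lower point `τ - i im τ/2`. [folklore] -/
theorem IsCuspFunction.exists_norm_ray_le_of_nonneg (hφ : IsCuspFunction h φ) (τ : ℍ) :
    ∃ C : ℝ, 0 ≤ C ∧ ∀ t : ℝ, 0 ≤ t →
      ‖φ (ofComplex ((τ : ℂ) + t * I))‖ ≤ C * Real.exp (-(2 * Real.pi / h) * t) := by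
  -- lower the base point to `τ₀ = re τ + i im τ / 2`
  set τ₀ : ℍ := ⟨(τ.re : ℂ) + (τ.im / 2 : ℝ) * I, by simpa using half_pos τ.im_pos⟩ with hτ₀
  set C₀ : ℝ := ∑' n : ℕ, ‖(qExpansion h φ).coeff n‖ * ‖Periodic.qParam h τ₀‖ ^ n
  have hC₀ : 0 ≤ C₀ := tsum_nonneg fun n ↦ by positivity
  refine ⟨C₀, hC₀, fun t ht ↦ ?_⟩
  have hs : 0 < τ.im / 2 + t := by have := τ.im_pos; positivity
  have key := hφ.norm_ray_le τ₀ hs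
  have hpt : (τ₀ : ℂ) + (τ.im / 2 + t : ℝ) * I = (τ : ℂ) + t * I := by
    rw [hτ₀, UpperHalfPlane.coe_mk]
    conv_rhs => rw [← UpperHalfPlane.re_add_im τ]
    push_cast
    ring
  rw [hpt] at key
  refine key.trans ?_
  refine mul_le_mul_of_nonneg_left (Real.exp_le_exp.mpr ?_) hC₀
  have : 0 < 2 * Real.pi / h := by have := hφ.pos; positivity
  nlinarith [τ.im_pos]

/-- `φ(τ + it)(τ + it)ᵐ → 0` as `t → ∞` for a cusp function `φ`. [folklore] -/
theorem IsCuspFunction.tendsto_ray_mul_pow (hφ : IsCuspFunction h φ) (τ : ℍ) (m : ℕ) :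
    Tendsto (fun t : ℝ ↦ φ (ofComplex ((τ : ℂ) + t * I)) * ((τ : ℂ) + t * I) ^ m) atTop (𝓝 0) := by
  obtain ⟨C, hC0, hC⟩ := hφ.exists_norm_ray_le_of_nonneg τ
  have ha : 0 < 2 * Real.pi / h := by have := hφ.pos; positivity
  have hmaj : Tendsto (fun t : ℝ ↦ C * ((‖(τ : ℂ)‖ + 1 * t) ^ m *
      Real.exp (-(2 * Real.pi / h) * t))) atTop (𝓝 0) := by
    have := (tendsto_affine_pow_mul_exp_neg_atTop ‖(τ : ℂ)‖ 1 m ha).const_mul C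
    rwa [mul_zero] at this
  refine squeeze_zero_norm' ?_ hmaj
  filter_upwards [eventually_ge_atTop (0 : ℝ)] with t ht
  rw [norm_mul, norm_pow, one_mul]
  have h2 : ‖(τ : ℂ) + t * I‖ ≤ ‖(τ : ℂ)‖ + t := by
    refine (norm_add_le _ _).trans ?_
    rw [norm_mul, Complex.norm_I, mul_one, Complex.norm_real, Real.norm_of_nonneg ht]
  calc ‖φ (ofComplex ((τ : ℂ) + t * I))‖ * ‖(τ : ℂ) + t * I‖ ^ m
      ≤ (C * Real.exp (-(2 * Real.pi / h) * t)) * (‖(τ : ℂ)‖ + t) ^ m := by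
        gcongr
        exact hC t ht
    _ = C * ((‖(τ : ℂ)‖ + t) ^ m * Real.exp (-(2 * Real.pi / h) * t)) := by ring

/-- The Eichler primitive along the ray, `t ↦ ∫_{τ+it}^{i∞} φ`, has derivative `-i φ(τ + it)`
(chain rule with `hasDerivAt_eichlerPrimitive`). [folklore] -/
theorem IsCuspFunction.hasDerivAt_eichlerPrimitive_ray (hφ : IsCuspFunction h φ) (τ : ℍ) {t : ℝ}
    (ht : 0 ≤ t) :
    HasDerivAt (fun s : ℝ ↦ eichlerPrimitive φ (ofComplex ((τ : ℂ) + s * I)))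
      (-φ (ofComplex ((τ : ℂ) + t * I)) * I) t := by
  have h1 := hφ.hasDerivAt_eichlerPrimitive (im_ray_pos τ ht)
  have h2 := hasDerivAt_ray (τ : ℂ) t
  have h3 := HasDerivAt.comp t h1 h2
  rwa [neg_mul] at h3 ⊢

/-- The power `(τ + it)^{m}` along the ray has derivative `m (τ + it)^{m-1} i`. [folklore] -/
theorem hasDerivAt_ray_pow (τ : ℂ) (m : ℕ) (t : ℝ) :
    HasDerivAt (fun s : ℝ ↦ (τ + s * I) ^ (m + 1)) (((m : ℂ) + 1) * (τ + t * I) ^ m * I) t := by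
  have h1 := hasDerivAt_pow (m + 1) (τ + t * I)
  have h2 := hasDerivAt_ray τ t
  have h3 := HasDerivAt.comp t h1 h2
  simp only [Nat.add_sub_cancel, Nat.cast_add, Nat.cast_one] at h3
  exact h3

/-- `ofComplex (τ + 0 i) = τ`. [folklore] -/
theorem ofComplex_ray_zero (τ : ℍ) : ofComplex ((τ : ℂ) + (0 : ℝ) * I) = τ := by
  rw [Complex.ofReal_zero, zero_mul, add_zero, ofComplex_apply]

/-- **The iterated Eichler integrals are honest integrals**: for a cusp function `φ`,
`powPrimitive j φ τ = ∫_τ^{i∞} φ(z) zʲ dz = i ∫₀^∞ φ(τ + it)(τ + it)ʲ dt` (the defining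
integration-by-parts recursion of `powPrimitive` is integration by parts in this integral).
[folklore] -/
theorem IsCuspFunction.powPrimitive_eq_integral (j : ℕ) :
    ∀ {φ : ℍ → ℂ}, IsCuspFunction h φ → ∀ τ : ℍ, powPrimitive j φ τ =
      I * ∫ t in Ioi (0 : ℝ), φ (ofComplex ((τ : ℂ) + t * I)) * ((τ : ℂ) + t * I) ^ j := by
  induction j with
  | zero =>
    intro φ hφ τ
    simp [eichlerPrimitive]
  | succ j ih =>
    intro φ hφ τ
    rw [powPrimitive_succ, ih hφ.primitive τ]
    -- integration by parts with `u = ∫_{τ+it}^{i∞} φ`, `v = (τ + it)^{j+1}`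
    set u : ℝ → ℂ := fun t ↦ eichlerPrimitive φ (ofComplex ((τ : ℂ) + t * I)) with hu
    set u' : ℝ → ℂ := fun t ↦ -φ (ofComplex ((τ : ℂ) + t * I)) * I with hu'
    set v : ℝ → ℂ := fun t ↦ ((τ : ℂ) + t * I) ^ (j + 1) with hv
    set v' : ℝ → ℂ := fun t ↦ ((j : ℂ) + 1) * ((τ : ℂ) + t * I) ^ j * I with hv'
    have hderu : ∀ t ∈ Ioi (0 : ℝ), HasDerivAt u (u' t) t := fun t ht ↦
      hφ.hasDerivAt_eichlerPrimitive_ray τ (le_of_lt ht)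
    have hderv : ∀ t ∈ Ioi (0 : ℝ), HasDerivAt v (v' t) t := fun t _ ↦
      hasDerivAt_ray_pow (τ : ℂ) j t
    have huv' : IntegrableOn (u * v') (Ioi 0) := by
      have h1 : IntegrableOn (fun t : ℝ ↦ eichlerPrimitive φ (ofComplex ((τ : ℂ) + t * I)) *
          ((τ : ℂ) + t * I) ^ j * (((j : ℂ) + 1) * I)) (Ioi 0) :=
        (hφ.primitive.integrableOn_ray_mul_pow τ j).mul_const _
      refine IntegrableOn.congr_fun h1 (fun t _ ↦ ?_) measurableSet_Ioi
      simp only [Pi.mul_apply, hu, hv']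
      ring
    have hu'v : IntegrableOn (u' * v) (Ioi 0) := by
      have h1 : IntegrableOn (fun t : ℝ ↦ (-I) * (φ (ofComplex ((τ : ℂ) + t * I)) *
          ((τ : ℂ) + t * I) ^ (j + 1))) (Ioi 0) :=
        (hφ.integrableOn_ray_mul_pow τ (j + 1)).const_mul (-I)
      refine IntegrableOn.congr_fun h1 (fun t _ ↦ ?_) measurableSet_Ioi
      simp only [Pi.mul_apply, hu', hv]
      ring
    have h_zero : Tendsto (u * v) (𝓝[>] 0) (𝓝 (eichlerPrimitive φ τ * (τ : ℂ) ^ (j + 1))) := by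
      have hcu : ContinuousAt u 0 := (hφ.hasDerivAt_eichlerPrimitive_ray τ le_rfl).continuousAt
      have hcv : ContinuousAt v 0 := (hasDerivAt_ray_pow (τ : ℂ) j 0).continuousAt
      have := (hcu.mul hcv).tendsto
      have h0 : u 0 * v 0 = eichlerPrimitive φ τ * (τ : ℂ) ^ (j + 1) := by
        simp only [hu, hv, Complex.ofReal_zero, zero_mul, add_zero, ofComplex_apply]
      rw [← h0]
      exact this.mono_left nhdsWithin_le_nhds
    have h_infty : Tendsto (u * v) atTop (𝓝 0) := hφ.primitive.tendsto_ray_mul_pow τ (j + 1)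
    have key := integral_Ioi_mul_deriv_eq_deriv_mul hderu hderv huv' hu'v h_zero h_infty
    -- rewrite both integrals in `key`
    have hI1 : ∫ t in Ioi (0 : ℝ), u t * v' t =
        (((j : ℂ) + 1) * I) * ∫ t in Ioi (0 : ℝ),
          eichlerPrimitive φ (ofComplex ((τ : ℂ) + t * I)) * ((τ : ℂ) + t * I) ^ j := by
      rw [← integral_const_mul]
      refine setIntegral_congr_fun measurableSet_Ioi fun t _ ↦ ?_
      simp only [hu, hv']
      ring
    have hI2 : ∫ t in Ioi (0 : ℝ), u' t * v t =
        (-I) * ∫ t in Ioi (0 : ℝ), φ (ofComplex ((τ : ℂ) + t * I)) * ((τ : ℂ) + t * I) ^ (j + 1) := by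
      rw [← integral_const_mul]
      refine setIntegral_congr_fun measurableSet_Ioi fun t _ ↦ ?_
      simp only [hu', hv]
      ring
    rw [hI1, hI2] at key
    linear_combination key

end Rays

/-! ### The period as the integral from the cusp -/

section CuspLimit

variable {N : ℕ} [NeZero N] {n : ℕ}

/-- The cusp `γ∞ = a/c ∈ ℚ` of `γ = (a b; c d)` (for `c ≠ 0`), as a real number. [folklore] -/
def cuspRe (γ : SL(2, ℤ)) : ℝ := ((γ 0 0 : ℤ) : ℝ) / ((γ 1 0 : ℤ) : ℝ)

omit [NeZero N] in
/-- **`γ` maps the vertical line `re z = -d/c` onto the vertical line above its cusp `a/c`**: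
`γ • (-d/c + iT) = a/c + i/(c²T)` for `γ = (a b; c d) ∈ SL(2, ℤ)`, `c ≠ 0`, `T > 0`. [folklore] -/
theorem sl_smul_ofComplex_vertical (γ : SL(2, ℤ)) (hc : (γ 1 0 : ℤ) ≠ 0) {T : ℝ} (hT : 0 < T) :
    γ • ofComplex (((-((γ 1 1 : ℤ) : ℝ) / ((γ 1 0 : ℤ) : ℝ) : ℝ) : ℂ) + T * I) =
      ofComplex (((cuspRe γ : ℝ) : ℂ) + ((1 / (((γ 1 0 : ℤ) : ℝ) ^ 2 * T) : ℝ) : ℂ) * I) := by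
  set z : ℂ := ((-((γ 1 1 : ℤ) : ℝ) / ((γ 1 0 : ℤ) : ℝ) : ℝ) : ℂ) + T * I with hz
  have him : 0 < z.im := by simp [hz, hT]
  rw [smul_ofComplex γ him]
  congr 1
  have hcC : ((γ 1 0 : ℤ) : ℂ) ≠ 0 := by exact_mod_cast hc
  have hTC : (T : ℂ) ≠ 0 := by exact_mod_cast hT.ne'
  have hdet : ((γ 0 0 : ℤ) : ℂ) * (γ 1 1 : ℤ) - (γ 0 1 : ℤ) * (γ 1 0 : ℤ) = 1 := by
    have h := Matrix.det_fin_two (γ : Matrix (Fin 2) (Fin 2) ℤ)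
    rw [γ.det_coe] at h
    exact_mod_cast h.symm
  have hden : ((γ 1 0 : ℤ) : ℂ) * z + (γ 1 1 : ℤ) = (γ 1 0 : ℤ) * T * I := by
    rw [hz]
    push_cast
    field_simp
    ring
  have hden0 : ((γ 1 0 : ℤ) : ℂ) * z + (γ 1 1 : ℤ) ≠ 0 := by
    rw [hden]
    exact mul_ne_zero (mul_ne_zero hcC hTC) I_ne_zero
  rw [moebius, div_eq_iff hden0, hden, cuspRe, hz]
  push_cast
  field_simp
  linear_combination -hdet - I_sq

/-- `ε ↦ 1/(c²ε)` tends to `+∞` as `ε → 0⁺`. [folklore] -/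
theorem tendsto_one_div_sq_mul_nhdsGT {c : ℝ} (hc : c ≠ 0) :
    Tendsto (fun ε : ℝ ↦ 1 / (c ^ 2 * ε)) (𝓝[>] 0) atTop := by
  have h1 : Tendsto (fun ε : ℝ ↦ (c ^ 2)⁻¹ * ε⁻¹) (𝓝[>] 0) atTop :=
    tendsto_inv_nhdsGT_zero.const_mul_atTop (inv_pos.mpr (by positivity))
  refine h1.congr fun ε ↦ ?_
  rw [one_div, mul_inv]

variable (n) in
/-- **The period is the integral from the cusp**: for `γ = (a b; c d) ∈ SL(2, ℤ)` with `c ≠ 0`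
and `f ∈ S_{n+2}(Γ₁(N))`, the kernel `∫_{a/c+iε}^{i∞} f(z)(zv' - u')ⁿ dz` (`(u', v') = γq`)
tends to `-c_f(γ)(q)` as `ε → 0⁺`: evaluate the `τ`-independent expression `periodFn1_eq` at
`τ = -d/c + iT`, `T = 1/(c²ε) → ∞`, where `γτ = a/c + iε` and the first term
`∫_τ^{i∞} (f|γ)(z)(zv - u)ⁿ dz → 0` (`tendsto_eichlerKernel_atTop`). [folklore] -/
theorem tendsto_eichlerKernel_cusp (f : CuspForm (Gamma1 N) (n + 2)) (γ : SL(2, ℤ))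
    (hc : (γ 1 0 : ℤ) ≠ 0) (q : Fin 2 → ℂ) :
    Tendsto (fun ε : ℝ ↦ eichlerKernel n ⇑f (ofComplex (((cuspRe γ : ℝ) : ℂ) + ε * I))
      ((icmat γ).mulVec q)) (𝓝[>] 0) (𝓝 (-periodFn1 n f γ q)) := by
  set c : ℝ := ((γ 1 0 : ℤ) : ℝ) with hcdef
  have hc' : c ≠ 0 := by rw [hcdef]; exact_mod_cast hc
  set x₀ : ℝ := -((γ 1 1 : ℤ) : ℝ) / ((γ 1 0 : ℤ) : ℝ) with hx₀
  -- the first term of `periodFn1_eq` tends to `0` along `τ = x₀ + iT`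
  have h1 : Tendsto (fun T : ℝ ↦ eichlerKernel n (⇑f ∣[(n + 2 : ℤ)] γ) (ofComplex ((x₀ : ℂ) + T * I)) q)
      atTop (𝓝 0) :=
    (isCuspFunction_slash_gamma1 f γ).tendsto_eichlerKernel_atTop x₀ q
  -- hence the second term tends to `-c_f(γ)(q)`
  have h2 : Tendsto (fun T : ℝ ↦ eichlerKernel n ⇑f (γ • ofComplex ((x₀ : ℂ) + T * I))
      ((icmat γ).mulVec q)) atTop (𝓝 (-periodFn1 n f γ q)) := by
    have := h1.sub_const (periodFn1 n f γ q)
    rw [zero_sub] at this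
    refine this.congr fun T ↦ ?_
    rw [periodFn1_eq f γ q (ofComplex ((x₀ : ℂ) + T * I))]
    ring
  -- rewrite `γ • (x₀ + iT) = a/c + i/(c²T)`
  have h3 : Tendsto (fun T : ℝ ↦ eichlerKernel n ⇑f
      (ofComplex (((cuspRe γ : ℝ) : ℂ) + ((1 / (c ^ 2 * T) : ℝ) : ℂ) * I)) ((icmat γ).mulVec q))
      atTop (𝓝 (-periodFn1 n f γ q)) := by
    refine h2.congr' ?_
    filter_upwards [eventually_gt_atTop (0 : ℝ)] with T hT
    rw [hx₀, sl_smul_ofComplex_vertical γ hc hT]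
  -- substitute `T = 1/(c²ε)`
  have h4 := h3.comp (tendsto_one_div_sq_mul_nhdsGT hc')
  refine h4.congr' ?_
  filter_upwards [self_mem_nhdsWithin] with ε (hε : 0 < ε)
  simp only [Function.comp_apply]
  congr 3
  have : 1 / (c ^ 2 * (1 / (c ^ 2 * ε))) = ε := by field_simp
  rw [this]

end CuspLimit

/-! ### Convergence of the moments `∫_{a/c+iε}^{i∞} f(z) zʲ dz` -/

section Moments

variable {N : ℕ} [NeZero N] {n : ℕ}

/-- The kernel at the `n + 1` integer points `(-i, 1)`, `i = 0, …, n`, is the evaluation matrix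
`(i^{n-j})` applied to the coefficient vector `(C(n,j) ∫_τ^{i∞} φ zʲ)_j`. [folklore] -/
theorem eichlerKernel_natPoints (φ : ℍ → ℂ) (τ : ℍ) (i : Fin (n + 1)) :
    eichlerKernel n φ τ ![-((i : ℕ) : ℂ), 1] =
      ∑ j : Fin (n + 1), ((i : ℕ) : ℂ) ^ (n - (j : ℕ)) * ((n.choose j : ℂ) * powPrimitive j φ τ) := by
  rw [eichlerKernel, Finset.sum_range (fun j ↦ (n.choose j : ℂ) * powPrimitive j φ τ *
    (![-((i : ℕ) : ℂ), 1] 1) ^ j * (-(![-((i : ℕ) : ℂ), 1] 0)) ^ (n - j))]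
  refine Finset.sum_congr rfl fun j _ ↦ ?_
  simp only [Matrix.cons_val_one, Matrix.cons_val_zero, one_pow, mul_one, neg_neg,
    Matrix.cons_val_fin_one]
  ring

variable (n) in
/-- The evaluation matrix `M_{ij} = i^{n-j}` (`i, j = 0, …, n`), a column-reversed Vandermonde
matrix. [folklore] -/
def momentMatrix : Matrix (Fin (n + 1)) (Fin (n + 1)) ℂ :=
  Matrix.of fun i j ↦ ((i : ℕ) : ℂ) ^ (n - (j : ℕ))

omit [NeZero N] in
/-- `momentMatrix` is the Vandermonde matrix of `0, 1, …, n` with columns reversed. [folklore] -/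
theorem momentMatrix_eq_submatrix :
    momentMatrix n = (Matrix.vandermonde fun i : Fin (n + 1) ↦ ((i : ℕ) : ℂ)).submatrix id
      ⇑(Fin.revPerm : Equiv.Perm (Fin (n + 1))) := by
  ext i j
  simp only [momentMatrix, Matrix.of_apply, Matrix.submatrix_apply, id_eq, Matrix.vandermonde_apply,
    Fin.revPerm_apply, Fin.val_rev]
  congr 1
  omega

omit [NeZero N] in
/-- `momentMatrix` is invertible (distinct nodes). [folklore] -/
theorem isUnit_det_momentMatrix : IsUnit (momentMatrix n).det := by
  rw [isUnit_iff_ne_zero, momentMatrix_eq_submatrix, Matrix.det_permute']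
  refine mul_ne_zero ?_ (Matrix.det_vandermonde_ne_zero_iff.mpr ?_)
  · exact Int.cast_ne_zero.mpr (Units.ne_zero _)
  · intro i j hij
    have hij' : ((i : ℕ) : ℂ) = ((j : ℕ) : ℂ) := hij
    exact Fin.ext (by exact_mod_cast hij')

variable (n) in
/-- **The cusp moments** `M_j(f; γ) = ∫_{a/c}^{i∞} f(z) zʲ dz := lim_{ε→0⁺} ∫_{a/c+iε}^{i∞} f(z) zʲ dz`
(`j ≤ n`, `γ∞ = a/c`; the limit exists by `tendsto_cuspMoment`). [folklore] -/
def cuspMoment (f : CuspForm (Gamma1 N) (n + 2)) (γ : SL(2, ℤ)) (j : ℕ) : ℂ :=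
  limUnder (𝓝[>] (0 : ℝ)) fun ε : ℝ ↦ powPrimitive j ⇑f (ofComplex (((cuspRe γ : ℝ) : ℂ) + ε * I))

/-- **Convergence of the cusp moments**: for `γ = (a b; c d) ∈ SL(2, ℤ)` with `c ≠ 0` and
`j ≤ n`, `∫_{a/c+iε}^{i∞} f(z) zʲ dz` converges as `ε → 0⁺` (to `cuspMoment n f γ j`).  The kernel
converges at every coefficient vector (`tendsto_eichlerKernel_cusp`), in particular at the `n + 1`
points `(-i, 1)`, where it is an invertible (Vandermonde) combination of the moments. [folklore] -/
theorem tendsto_cuspMoment (f : CuspForm (Gamma1 N) (n + 2)) (γ : SL(2, ℤ)) (hc : (γ 1 0 : ℤ) ≠ 0)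
    {j : ℕ} (hj : j ≤ n) :
    Tendsto (fun ε : ℝ ↦ powPrimitive j ⇑f (ofComplex (((cuspRe γ : ℝ) : ℂ) + ε * I)))
      (𝓝[>] 0) (𝓝 (cuspMoment n f γ j)) := by
  classical
  -- coefficient vectors `w(ε)_j = C(n,j) ∫ f zʲ` and kernel values `k(ε)_i = K(ε)(-i, 1)`
  set τε : ℝ → ℍ := fun ε ↦ ofComplex (((cuspRe γ : ℝ) : ℂ) + ε * I) with hτε
  set w : ℝ → Fin (n + 1) → ℂ := fun ε j ↦ (n.choose j : ℂ) * powPrimitive j ⇑f (τε ε) with hw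
  set M := momentMatrix n with hM
  have hk : ∀ ε, M.mulVec (w ε) = fun i : Fin (n + 1) ↦ eichlerKernel n ⇑f (τε ε) ![-((i : ℕ) : ℂ), 1] := by
    intro ε
    funext i
    rw [eichlerKernel_natPoints, Matrix.mulVec, dotProduct]
    rfl
  -- each kernel value converges
  have hlim : ∀ i : Fin (n + 1), Tendsto (fun ε ↦ eichlerKernel n ⇑f (τε ε) ![-((i : ℕ) : ℂ), 1])
      (𝓝[>] 0) (𝓝 (-periodFn1 n f γ ((icmat γ⁻¹).mulVec ![-((i : ℕ) : ℂ), 1]))) := by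
    intro i
    have h := tendsto_eichlerKernel_cusp n f γ hc ((icmat γ⁻¹).mulVec ![-((i : ℕ) : ℂ), 1])
    have hq : (icmat γ).mulVec ((icmat γ⁻¹).mulVec ![-((i : ℕ) : ℂ), 1]) = ![-((i : ℕ) : ℂ), 1] := by
      have h1 : icmat (1 : SL(2, ℤ)) = 1 := by
        change ((1 : SL(2, ℤ)) : Matrix (Fin 2) (Fin 2) ℤ).map (Int.cast : ℤ → ℂ) = 1
        rw [Matrix.SpecialLinearGroup.coe_one]
        exact Matrix.map_one _ Int.cast_zero Int.cast_one
      rw [Matrix.mulVec_mulVec, ← icmat_mul, mul_inv_cancel, h1, Matrix.one_mulVec]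
    simpa only [hq] using h
  set L : Fin (n + 1) → ℂ := fun i ↦ -periodFn1 n f γ ((icmat γ⁻¹).mulVec ![-((i : ℕ) : ℂ), 1])
  have hMw : Tendsto (fun ε ↦ M.mulVec (w ε)) (𝓝[>] 0) (𝓝 L) := by
    simp_rw [hk]
    exact tendsto_pi_nhds.mpr hlim
  -- invert `M`
  have hwlim : Tendsto w (𝓝[>] 0) (𝓝 (M⁻¹.mulVec L)) := by
    have hcont : Continuous fun v : Fin (n + 1) → ℂ ↦ M⁻¹.mulVec v :=
      (Matrix.mulVecLin M⁻¹).continuous_of_finiteDimensional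
    have := (hcont.tendsto L).comp hMw
    refine this.congr fun ε ↦ ?_
    rw [Function.comp_apply, Matrix.mulVec_mulVec, hM, Matrix.nonsing_inv_mul _ isUnit_det_momentMatrix,
      Matrix.one_mulVec]
  -- extract the coordinate `j`
  have hj' : j < n + 1 := Nat.lt_succ_of_le hj
  have hcoord : Tendsto (fun ε ↦ w ε ⟨j, hj'⟩) (𝓝[>] 0) (𝓝 ((M⁻¹.mulVec L) ⟨j, hj'⟩)) :=
    (continuous_apply _).tendsto _ |>.comp hwlim
  have hC : (n.choose j : ℂ) ≠ 0 := by exact_mod_cast (Nat.choose_pos hj).ne'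
  have hP : Tendsto (fun ε ↦ powPrimitive j ⇑f (τε ε)) (𝓝[>] 0)
      (𝓝 ((n.choose j : ℂ)⁻¹ * (M⁻¹.mulVec L) ⟨j, hj'⟩)) := by
    have := hcoord.const_mul ((n.choose j : ℂ)⁻¹)
    refine this.congr fun ε ↦ ?_
    simp only [hw, ← mul_assoc, inv_mul_cancel₀ hC, one_mul]
  exact tendsto_nhds_limUnder ⟨_, hP⟩

/-- **The period in terms of the cusp moments**: for `γ = (a b; c d)` with `c ≠ 0`,
`-c_f(γ)(q) = ∑ⱼ C(n,j) M_j(f; γ) v'ʲ (-u')ⁿ⁻ʲ`, `(u', v') = γq` — the limit of the defining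
expression of the kernel. [folklore] -/
theorem neg_periodFn1_eq_sum_cuspMoment (f : CuspForm (Gamma1 N) (n + 2)) (γ : SL(2, ℤ))
    (hc : (γ 1 0 : ℤ) ≠ 0) (q : Fin 2 → ℂ) :
    -periodFn1 n f γ q = ∑ j ∈ Finset.range (n + 1), (n.choose j : ℂ) * cuspMoment n f γ j *
      ((icmat γ).mulVec q 1) ^ j * (-((icmat γ).mulVec q 0)) ^ (n - j) := by
  have h1 := tendsto_eichlerKernel_cusp n f γ hc q
  have h2 : Tendsto (fun ε : ℝ ↦ eichlerKernel n ⇑f (ofComplex (((cuspRe γ : ℝ) : ℂ) + ε * I))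
      ((icmat γ).mulVec q)) (𝓝[>] 0) (𝓝 (∑ j ∈ Finset.range (n + 1), (n.choose j : ℂ) *
        cuspMoment n f γ j * ((icmat γ).mulVec q 1) ^ j * (-((icmat γ).mulVec q 0)) ^ (n - j))) := by
    simp only [eichlerKernel]
    refine tendsto_finsetSum _ fun j hj ↦ ?_
    have hjn : j ≤ n := Nat.lt_succ_iff.mp (Finset.mem_range.mp hj)
    exact (((tendsto_cuspMoment f γ hc hjn).const_mul _).mul_const _).mul_const _
  exact tendsto_nhds_unique h1 h2

end Moments

/-! ### Centred moments of large order as absolutely convergent integrals -/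

section Centred

variable {N : ℕ} [NeZero N] {n : ℕ}

/-- **Binomial re-centring at finite height**: for a cusp function `φ`, `τ ∈ ℍ` and `x ∈ ℂ`,
`∑ᵢ C(j,i) (∫_τ^{i∞} φ zⁱ dz) (-x)^{j-i} = ∫_τ^{i∞} φ(z)(z - x)ʲ dz = i∫₀^∞ φ(τ+it)(τ+it-x)ʲ dt`.
[folklore] -/
theorem IsCuspFunction.sum_choose_powPrimitive_eq_integral {h : ℝ} {φ : ℍ → ℂ}
    (hφ : IsCuspFunction h φ) (τ : ℍ) (x : ℂ) (j : ℕ) :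
    ∑ i ∈ Finset.range (j + 1), (j.choose i : ℂ) * powPrimitive i φ τ * (-x) ^ (j - i) =
      I * ∫ t in Ioi (0 : ℝ), φ (ofComplex ((τ : ℂ) + t * I)) * ((τ : ℂ) + t * I - x) ^ j := by
  have hint : ∀ i, IntegrableOn (fun t : ℝ ↦ φ (ofComplex ((τ : ℂ) + t * I)) *
      ((τ : ℂ) + t * I) ^ i * ((j.choose i : ℂ) * (-x) ^ (j - i))) (Ioi 0) := fun i ↦
    (hφ.integrableOn_ray_mul_pow τ i).mul_const _
  calc ∑ i ∈ Finset.range (j + 1), (j.choose i : ℂ) * powPrimitive i φ τ * (-x) ^ (j - i)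
      = ∑ i ∈ Finset.range (j + 1), I * ∫ t in Ioi (0 : ℝ), φ (ofComplex ((τ : ℂ) + t * I)) *
          ((τ : ℂ) + t * I) ^ i * ((j.choose i : ℂ) * (-x) ^ (j - i)) := by
        refine Finset.sum_congr rfl fun i _ ↦ ?_
        rw [hφ.powPrimitive_eq_integral i τ, integral_mul_const]
        ring
    _ = I * ∫ t in Ioi (0 : ℝ), ∑ i ∈ Finset.range (j + 1), φ (ofComplex ((τ : ℂ) + t * I)) *
          ((τ : ℂ) + t * I) ^ i * ((j.choose i : ℂ) * (-x) ^ (j - i)) := by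
        rw [← Finset.mul_sum, integral_finsetSum _ fun i _ ↦ hint i]
    _ = I * ∫ t in Ioi (0 : ℝ), φ (ofComplex ((τ : ℂ) + t * I)) * ((τ : ℂ) + t * I - x) ^ j := by
        congr 1
        refine setIntegral_congr_fun measurableSet_Ioi fun t _ ↦ ?_
        rw [sub_eq_add_neg, add_pow, Finset.mul_sum]
        refine Finset.sum_congr rfl fun i _ ↦ ?_
        ring

/-- The integrand `s ↦ f(x + is)(is)ʲ` of the centred cusp moment. [folklore] -/
def cuspRayFn (n : ℕ) (f : CuspForm (Gamma1 N) (n + 2)) (x : ℝ) (j : ℕ) (s : ℝ) : ℂ :=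
  f (ofComplex ((x : ℂ) + s * I)) * ((s : ℂ) * I) ^ j

/-- `cuspRayFn` is continuous on `(0, ∞)`. [folklore] -/
theorem continuousOn_cuspRayFn (f : CuspForm (Gamma1 N) (n + 2)) (x : ℝ) (j : ℕ) :
    ContinuousOn (cuspRayFn n f x j) (Ioi 0) := by
  refine ContinuousOn.mul ?_ (by fun_prop)
  refine (isCuspFunction_one_gamma1 f).continuousOn_comp_ofComplex.comp (by fun_prop) fun s hs ↦ ?_
  simpa using hs

/-- **Integrability of `f(x + is)(is)ʲ` on `(0, ∞)` for `2j > n`** (`f ∈ S_{n+2}(Γ₁(N))`): near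
`∞` exponential decay, near `0` the bound `|f(z)| ≤ C (im z)^{-(n+2)/2}` of cusp forms
(Mathlib `CuspFormClass.exists_bound`) gives `O(s^{j-(n+2)/2})` with `j - (n+2)/2 > -1`. [folklore] -/
theorem integrableOn_cuspRayFn (f : CuspForm (Gamma1 N) (n + 2)) (x : ℝ) {j : ℕ} (hj : n < 2 * j) :
    IntegrableOn (cuspRayFn n f x j) (Ioi 0) := by
  have hIoi : Ioi (0 : ℝ) = Ioc 0 1 ∪ Ioi 1 := (Ioc_union_Ioi_eq_Ioi zero_le_one).symm
  rw [hIoi]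
  refine IntegrableOn.union ?_ ?_
  · -- near `0`
    obtain ⟨C, hC⟩ := CuspFormClass.exists_bound (k := (n + 2 : ℤ)) f
    set r : ℝ := (j : ℝ) - ((n : ℝ) + 2) / 2 with hr
    have hr1 : -1 < r := by
      rw [hr]
      have : (n : ℝ) < 2 * j := by exact_mod_cast hj
      linarith
    have hg : IntegrableOn (fun s : ℝ ↦ C * s ^ r) (Ioc 0 1) := by
      have := (intervalIntegral.intervalIntegrable_rpow' hr1 (a := 0) (b := 1)).1
      exact (this.const_mul C)
    refine Integrable.mono' hg ?_ ?_
    · exact ((continuousOn_cuspRayFn f x j).mono Ioc_subset_Ioi_self).aestronglyMeasurable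
        measurableSet_Ioc
    · rw [ae_restrict_iff' measurableSet_Ioc]
      refine Eventually.of_forall fun s hs ↦ ?_
      have hs0 : 0 < s := hs.1
      have him : (ofComplex ((x : ℂ) + s * I)).im = s := by
        rw [← UpperHalfPlane.coe_im, coe_ofComplex (by simpa using hs0)]
        simp
      rw [cuspRayFn, norm_mul, norm_pow, norm_mul, Complex.norm_I, mul_one, Complex.norm_real,
        Real.norm_of_nonneg hs0.le]
      have h1 := hC (ofComplex ((x : ℂ) + s * I))
      rw [him] at h1
      have hk : (((n + 2 : ℤ) : ℝ) / 2) = ((n : ℝ) + 2) / 2 := by push_cast; ring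
      rw [hk] at h1
      calc ‖f (ofComplex ((x : ℂ) + s * I))‖ * s ^ j
          ≤ (C / s ^ (((n : ℝ) + 2) / 2)) * s ^ j := by gcongr
        _ = C * s ^ r := by
            rw [hr, Real.rpow_sub hs0, ← Real.rpow_natCast s j]
            ring
  · -- near `∞`: ray from `τ₁ = x + i`
    set τ₁ : ℍ := ofComplex ((x : ℂ) + (1 : ℝ) * I) with hτ₁
    have hτ₁c : (τ₁ : ℂ) = (x : ℂ) + I := by
      rw [hτ₁, coe_ofComplex (by simp)]
      simp
    rw [integrableOn_Ioi_iff_integrableOn_Ioi_add]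
    obtain ⟨C, hC0, hC⟩ := (isCuspFunction_one_gamma1 f).exists_norm_ray_le_of_nonneg τ₁
    have ha : 0 < 2 * Real.pi / 1 := by positivity
    refine Integrable.mono' (integrableOn_affine_pow_mul_exp_neg C 1 j ha) ?_ ?_
    · refine ContinuousOn.aestronglyMeasurable ?_ measurableSet_Ioi
      exact (continuousOn_cuspRayFn f x j).comp (by fun_prop) fun t (ht : 0 < t) ↦ by
        show 0 < t + 1; linarith
    · rw [ae_restrict_iff' measurableSet_Ioi]
      refine Eventually.of_forall fun t (ht : 0 < t) ↦ ?_
      have hpt : (x : ℂ) + ((t + 1 : ℝ) : ℂ) * I = (τ₁ : ℂ) + t * I := by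
        rw [hτ₁c]; push_cast; ring
      rw [cuspRayFn, hpt, norm_mul, norm_pow, norm_mul, Complex.norm_I, mul_one, Complex.norm_real,
        Real.norm_of_nonneg (by linarith)]
      calc ‖f (ofComplex ((τ₁ : ℂ) + t * I))‖ * (t + 1) ^ j
          ≤ (C * Real.exp (-(2 * Real.pi / 1) * t)) * (1 + t) ^ j := by
            rw [add_comm t 1]
            gcongr
            exact hC t ht.le
        _ = C * (1 + t) ^ j * Real.exp (-(2 * Real.pi / 1) * t) := by ring

omit [NeZero N] in
/-- **The tail integrals converge**: `∫_ε^∞ F → ∫₀^∞ F` as `ε → 0⁺` for `F` integrable on `(0, ∞)`.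
[folklore] -/
theorem tendsto_integral_Ioi_of_integrableOn {F : ℝ → ℂ} (hF : IntegrableOn F (Ioi 0)) :
    Tendsto (fun ε : ℝ ↦ ∫ s in Ioi ε, F s) (𝓝[>] 0) (𝓝 (∫ s in Ioi 0, F s)) := by
  -- `∫_{(0,ε]} F → 0`
  have hsmall : Tendsto (fun ε : ℝ ↦ ∫ s in Ioc 0 ε, F s) (𝓝[>] 0) (𝓝 0) := by
    have hF' : Integrable F (volume.restrict (Ioi 0)) := hF
    have hmeas : Tendsto ((volume.restrict (Ioi (0 : ℝ))) ∘ fun ε : ℝ ↦ Ioc 0 ε) (𝓝[>] 0) (𝓝 0) := by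
      have h1 : Tendsto (fun ε : ℝ ↦ ENNReal.ofReal ε) (𝓝[>] 0) (𝓝 0) := by
        have := (ENNReal.tendsto_ofReal (tendsto_id (x := 𝓝 (0 : ℝ))))
        rw [ENNReal.ofReal_zero] at this
        exact this.mono_left nhdsWithin_le_nhds
      refine tendsto_of_tendsto_of_tendsto_of_le_of_le tendsto_const_nhds h1 (fun _ ↦ zero_le)
        fun ε ↦ ?_
      simp only [Function.comp_apply]
      rw [Measure.restrict_apply measurableSet_Ioc]
      calc volume (Ioc 0 ε ∩ Ioi 0) ≤ volume (Ioc 0 ε) := measure_mono Set.inter_subset_left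
        _ = ENNReal.ofReal (ε - 0) := Real.volume_Ioc
        _ = ENNReal.ofReal ε := by rw [sub_zero]
    have := hF'.tendsto_setIntegral_nhds_zero hmeas
    refine this.congr fun ε ↦ ?_
    rw [Measure.restrict_restrict measurableSet_Ioc, Set.inter_eq_left.mpr Ioc_subset_Ioi_self]
  have hsplit : ∀ ε : ℝ, 0 < ε → ∫ s in Ioi ε, F s = (∫ s in Ioi 0, F s) - ∫ s in Ioc 0 ε, F s := by
    intro ε hε
    rw [eq_sub_iff_add_eq, add_comm, ← setIntegral_union (Set.Ioc_disjoint_Ioi le_rfl)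
      measurableSet_Ioi (hF.mono_set Ioc_subset_Ioi_self) (hF.mono_set (Ioi_subset_Ioi hε.le)),
      Ioc_union_Ioi_eq_Ioi hε.le]
  have := (tendsto_const_nhds (x := ∫ s in Ioi 0, F s)).sub hsmall
  rw [sub_zero] at this
  refine this.congr' ?_
  filter_upwards [self_mem_nhdsWithin] with ε hε
  exact (hsplit ε hε).symm

variable (n) in
/-- **The centred cusp moments** `Q_j(f; γ) = ∑ᵢ C(j,i) M_i(f; γ) (-a/c)^{j-i}`
("`∫_{a/c}^{i∞} f(z)(z - a/c)ʲ dz`"). [folklore] -/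
def cuspCentredMoment (f : CuspForm (Gamma1 N) (n + 2)) (γ : SL(2, ℤ)) (j : ℕ) : ℂ :=
  ∑ i ∈ Finset.range (j + 1), (j.choose i : ℂ) * cuspMoment n f γ i * (-((cuspRe γ : ℝ) : ℂ)) ^ (j - i)

/-- **Centred cusp moments of order `j > n/2` are absolutely convergent integrals from the cusp**:
for `γ = (a b; c d) ∈ SL(2, ℤ)`, `c ≠ 0`, `f ∈ S_{n+2}(Γ₁(N))` and `n/2 < j ≤ n`,
`Q_j(f; γ) = i ∫₀^∞ f(a/c + is)(is)ʲ ds` — both sides are the limit as `ε → 0⁺` of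
`∫_{a/c+iε}^{i∞} f(z)(z - a/c)ʲ dz = i ∫_ε^∞ f(a/c + is)(is)ʲ ds`. [folklore] -/
theorem cuspCentredMoment_eq_integral (f : CuspForm (Gamma1 N) (n + 2)) (γ : SL(2, ℤ))
    (hc : (γ 1 0 : ℤ) ≠ 0) {j : ℕ} (hjn : j ≤ n) (hj : n < 2 * j) :
    cuspCentredMoment n f γ j = I * ∫ s in Ioi (0 : ℝ), cuspRayFn n f (cuspRe γ) j s := by
  set x : ℝ := cuspRe γ with hx
  set G : ℝ → ℂ := fun ε ↦ ∑ i ∈ Finset.range (j + 1), (j.choose i : ℂ) *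
    powPrimitive i ⇑f (ofComplex ((x : ℂ) + ε * I)) * (-(x : ℂ)) ^ (j - i) with hG
  -- limit 1: the centred moment
  have h1 : Tendsto G (𝓝[>] 0) (𝓝 (cuspCentredMoment n f γ j)) := by
    refine tendsto_finsetSum _ fun i hi ↦ ?_
    have hin : i ≤ n := (Nat.lt_succ_iff.mp (Finset.mem_range.mp hi)).trans hjn
    exact ((tendsto_cuspMoment f γ hc hin).const_mul _).mul_const _
  -- limit 2: the tail integrals
  have hF := integrableOn_cuspRayFn f x hj
  have h2 : Tendsto G (𝓝[>] 0) (𝓝 (I * ∫ s in Ioi (0 : ℝ), cuspRayFn n f x j s)) := by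
    have := (tendsto_integral_Ioi_of_integrableOn hF).const_mul I
    refine this.congr' ?_
    filter_upwards [self_mem_nhdsWithin] with ε (hε : 0 < ε)
    have him : 0 < ((x : ℂ) + ε * I).im := by simpa using hε
    rw [hG]
    simp only
    rw [(isCuspFunction_one_gamma1 f).sum_choose_powPrimitive_eq_integral _ (x : ℂ) j,
      integral_Ioi_eq_integral_Ioi_add _ ε]
    congr 1
    refine setIntegral_congr_fun measurableSet_Ioi fun t _ ↦ ?_
    rw [cuspRayFn, coe_ofComplex him]
    push_cast
    ring_nf
  exact tendsto_nhds_unique h1 h2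

end Centred

end Literature.NumberTheory.EllipticCurves.ModularForms
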